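import Literature.MathematicalPhysics.KineticTheory.HardSphereMarginalTrace
import Literature.Analysis.FluidPDE.HardSphereTrajectoryMeasurable
import HarnessLib

/-!
# The displacement of a hard sphere along a good orbit is bounded by its path length

(Folklore; Gallagher–Saint-Raymond–Texier 2013 §4.1, Prop. 4.1.1 and Def. 4.1.2: outside a null
set the hard-sphere dynamics is globally defined, with locally finitely many collisions, and its
trajectories are piecewise free flight with continuous positions. Companion of §1 of
`Literature/MathematicalPhysics/KineticTheory/HardSphereMarginalTrace.lean`
(`HardSphereFlow.euclidDist_flow_self_le`), which bounds the same displacement by the cruder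
`√(2E(z)) (t₂ - t₁)`, `E(z)` the TOTAL kinetic energy; topic MathematicalPhysics/KineticTheory.)

For a hard-sphere flow `Φ` on the flat torus `T^d` (`HardSphereFlow (Torus.geometry d) ε N`), a
good initial datum `z ∈ Φ.good`, a particle `i` and times `t₁ ≤ t₂` we PROVE the pathwise
**path-length bound**

  `dist_{T^d}(x_i(t₂), x_i(t₁)) ≤ ∫_{t₁}^{t₂} ‖v_i(u)‖ du`

(`HardSphereFlow.euclidDist_flow_le_integral_norm_vel`; `dist_{T^d}` is the minimal-image distance
`Torus.euclidDist`, the integral is Mathlib's interval integral w.r.t. Lebesgue measure).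

Proof: continuous induction on `[t₁, t₂]` (`IsClosed.Icc_subset_of_forall_mem_nhdsWithin`), as
in `HardSphereFlow.euclidDist_flow_self_le`. The set of times `t` at which the bound holds is
closed — positions are continuous (`IsHardSphereTrajectory.pos_continuous`,
`Torus.continuous_euclidDist`) and the primitive of the locally integrable speed is continuous
(`intervalIntegral.continuous_primitive`) — and contains `t₁`. Every time `x` has a collision-free
interval `(x, u)` to its right (`IsHardSphereTrajectory.exists_Ioo_right_free`), and on `[x, u)`
the orbit is the free flight issued from time `x` (`eq_freeFlight_of_Ioo_free`): for `t ∈ (x, u)`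
the position `x_i(t) = x_i(x) + (t - x) v_i(x)` is within `(t - x) ‖v_i(x)‖` of `x_i(x)`
(`euclidDist_add_proj_self_le`) while the velocity is constant, so that
`∫_x^t ‖v_i‖ = (t - x) ‖v_i(x)‖`; the triangle inequality (`torus_euclidDist_triangle`) and
`∫_{t₁}^x + ∫_x^t = ∫_{t₁}^t` (`intervalIntegral.integral_add_adjacent_intervals`) propagate the
bound from `x` to `(x, u)`.

Contents.
* §1 The speed `u ↦ ‖v_i(u)‖` along a good orbit is Borel measurable in time
  (`IsHardSphereTrajectory.measurable_torus`) and bounded by `√(2E(z))`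
  (`HardSphereFlow.norm_vel_flow_le`): integrable on every set of finite measure, interval
  integrable on every bounded interval (`HardSphereFlow.intervalIntegrable_norm_vel_flow`), with a
  continuous primitive, `∫_{t₁}^{t₂} ‖v_i‖ ≤ √(2E(z)) (t₂ - t₁)`, and monotone in the interval;
  the same integrability for the squared speed (bounded by `2E(z)`).
* §2 Free stretches: constant velocity, `∫_x^t ‖v_i‖ = (t - x) ‖v_i(x)‖`, displacement
  `≤ (t - x) ‖v_i(x)‖`.
* §3 **The path-length bound** and its variants: free order of the two times (`uIoc`), inside a
  window `[a, b]`, and as set integrals over `Icc` / `Ico` / `Ioc` / `Ioo`.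

Design: theorems only (no definitions); flat torus only (the minimal-image distance is the torus
notion). Deliberately NOT here: the Cauchy–Schwarz step `(∫_{t₁}^{t₂} ‖v_i‖)² ≤ (t₂ - t₁)
∫_{t₁}^{t₂} ‖v_i‖²` (a general fact, `sq_integral_le_mul_integral_sq` of
`Literature/Analysis/FunctionSpaces/ItoProcessesProofs.lean`) and averaged (mean-displacement)
statements under an invariant law.

## References

* I. Gallagher, L. Saint-Raymond, B. Texier, *From Newton to Boltzmann: hard spheres and
  short-range potentials*, Zurich Lectures in Advanced Mathematics, EMS (2013), arXiv:1208.5753,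
  §4.1 (Prop. 4.1.1, Def. 4.1.2).
-/

open MeasureTheory Set Filter Function
open scoped Topology Interval
open Literature.Analysis.FluidPDE

namespace Literature.MathematicalPhysics.KineticTheory

noncomputable section

variable {d : Type*} [Fintype d] {ε : ℝ} {N : ℕ}

/-! ## §1. The speed along a good orbit: measurable, bounded, locally integrable -/

section Speed

/-- The velocity `u ↦ v_i(u)` of particle `i` along a good orbit on the torus is a Borel
measurable function of time (a right-continuous step function;
`IsHardSphereTrajectory.measurable_torus`). Not to be confused with
`HardSphereFlow.measurable_vel_flow` (measurability in the initial datum at a fixed time).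
[folklore] -/
theorem _root_.Literature.Analysis.FluidPDE.HardSphereFlow.measurable_vel_orbit
    (Φ : HardSphereFlow (Torus.geometry d) ε N) {z : Config N d (UnitAddTorus d)} (hz : z ∈ Φ.good)
    (i : Fin N) : Measurable fun u => (Φ.flow u z i).2 :=
  ((measurable_pi_apply i).comp (Φ.isTrajectory z hz).measurable_torus).snd

/-- The speed `u ↦ ‖v_i(u)‖` of particle `i` along a good orbit is Borel measurable in time.
[folklore] -/
theorem _root_.Literature.Analysis.FluidPDE.HardSphereFlow.measurable_norm_vel_orbit
    (Φ : HardSphereFlow (Torus.geometry d) ε N) {z : Config N d (UnitAddTorus d)} (hz : z ∈ Φ.good)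
    (i : Fin N) : Measurable fun u => ‖(Φ.flow u z i).2‖ :=
  (Φ.measurable_vel_orbit hz i).norm

/-- **The speed along a good orbit is integrable on every set of finite Lebesgue measure**
(measurable, and bounded by `√(2E(z))` by conservation of energy,
`HardSphereFlow.norm_vel_flow_le`). [folklore] -/
theorem _root_.Literature.Analysis.FluidPDE.HardSphereFlow.integrableOn_norm_vel_flow
    (Φ : HardSphereFlow (Torus.geometry d) ε N) {z : Config N d (UnitAddTorus d)} (hz : z ∈ Φ.good)
    (i : Fin N) {s : Set ℝ} (hs : volume s ≠ ⊤) :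
    IntegrableOn (fun u => ‖(Φ.flow u z i).2‖) s volume :=
  Measure.integrableOn_of_bounded hs (Φ.measurable_norm_vel_orbit hz i).aestronglyMeasurable
    (ae_of_all _ fun u => by
      rw [norm_norm]
      exact Φ.norm_vel_flow_le hz u i)

/-- **The speed along a good orbit is interval integrable on every bounded interval.**
[folklore] -/
theorem _root_.Literature.Analysis.FluidPDE.HardSphereFlow.intervalIntegrable_norm_vel_flow
    (Φ : HardSphereFlow (Torus.geometry d) ε N) {z : Config N d (UnitAddTorus d)} (hz : z ∈ Φ.good)
    (i : Fin N) (t₁ t₂ : ℝ) :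
    IntervalIntegrable (fun u => ‖(Φ.flow u z i).2‖) volume t₁ t₂ :=
  ⟨Φ.integrableOn_norm_vel_flow hz i measure_Ioc_lt_top.ne,
    Φ.integrableOn_norm_vel_flow hz i measure_Ioc_lt_top.ne⟩

/-- The squared speed `u ↦ ‖v_i(u)‖²` along a good orbit is interval integrable on every bounded
interval (measurable, bounded by `2E(z)`). [folklore] -/
theorem _root_.Literature.Analysis.FluidPDE.HardSphereFlow.intervalIntegrable_norm_vel_sq_flow
    (Φ : HardSphereFlow (Torus.geometry d) ε N) {z : Config N d (UnitAddTorus d)} (hz : z ∈ Φ.good)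
    (i : Fin N) (t₁ t₂ : ℝ) :
    IntervalIntegrable (fun u => ‖(Φ.flow u z i).2‖ ^ 2) volume t₁ t₂ :=
  (intervalIntegrable_const (c := 2 * configEnergy z)).mono_fun'
    ((Φ.measurable_norm_vel_orbit hz i).pow_const 2).aestronglyMeasurable
    (ae_of_all _ fun u => by
      dsimp only
      rw [Real.norm_eq_abs, abs_pow, abs_norm, ← Φ.configEnergy_flow hz u]
      exact norm_vel_sq_le_two_mul_configEnergy _ i)

/-- The primitive `t ↦ ∫_a^t ‖v_i(u)‖ du` of the speed along a good orbit is continuous.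
[folklore] -/
theorem _root_.Literature.Analysis.FluidPDE.HardSphereFlow.continuous_integral_norm_vel_flow
    (Φ : HardSphereFlow (Torus.geometry d) ε N) {z : Config N d (UnitAddTorus d)} (hz : z ∈ Φ.good)
    (i : Fin N) (a : ℝ) : Continuous fun t => ∫ u in a..t, ‖(Φ.flow u z i).2‖ :=
  intervalIntegral.continuous_primitive (Φ.intervalIntegrable_norm_vel_flow hz i) a

/-- The path length `∫_{t₁}^{t₂} ‖v_i‖` over `t₁ ≤ t₂` is nonnegative. [folklore] -/
theorem _root_.Literature.Analysis.FluidPDE.HardSphereFlow.integral_norm_vel_flow_nonneg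
    (Φ : HardSphereFlow (Torus.geometry d) ε N) (z : Config N d (UnitAddTorus d)) (i : Fin N)
    {t₁ t₂ : ℝ} (h12 : t₁ ≤ t₂) : 0 ≤ ∫ u in t₁..t₂, ‖(Φ.flow u z i).2‖ :=
  intervalIntegral.integral_nonneg h12 fun _ _ => norm_nonneg _

/-- **The path length is at most `√(2E(z)) (t₂ - t₁)`** (`‖v_i(u)‖ ≤ √(2E(z))`): the path-length
displacement bound below refines `HardSphereFlow.euclidDist_flow_self_le`. [folklore] -/
theorem _root_.Literature.Analysis.FluidPDE.HardSphereFlow.integral_norm_vel_flow_le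
    (Φ : HardSphereFlow (Torus.geometry d) ε N) {z : Config N d (UnitAddTorus d)} (hz : z ∈ Φ.good)
    (i : Fin N) {t₁ t₂ : ℝ} (h12 : t₁ ≤ t₂) :
    ∫ u in t₁..t₂, ‖(Φ.flow u z i).2‖ ≤ Real.sqrt (2 * configEnergy z) * (t₂ - t₁) := by
  have h := intervalIntegral.integral_mono_on h12 (Φ.intervalIntegrable_norm_vel_flow hz i t₁ t₂)
    intervalIntegrable_const fun u _ => Φ.norm_vel_flow_le hz u i
  rwa [intervalIntegral.integral_const, smul_eq_mul, mul_comm] at h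

/-- The path length is monotone in the interval: `[a, b] ⊆ [a', b']` gives
`∫_a^b ‖v_i‖ ≤ ∫_{a'}^{b'} ‖v_i‖`. [folklore] -/
theorem _root_.Literature.Analysis.FluidPDE.HardSphereFlow.integral_norm_vel_flow_mono
    (Φ : HardSphereFlow (Torus.geometry d) ε N) {z : Config N d (UnitAddTorus d)} (hz : z ∈ Φ.good)
    (i : Fin N) {a b a' b' : ℝ} (ha : a' ≤ a) (hab : a ≤ b) (hb : b ≤ b') :
    ∫ u in a..b, ‖(Φ.flow u z i).2‖ ≤ ∫ u in a'..b', ‖(Φ.flow u z i).2‖ :=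
  intervalIntegral.integral_mono_interval ha hab hb (ae_of_all _ fun _ => norm_nonneg _)
    (Φ.intervalIntegrable_norm_vel_flow hz i a' b')

end Speed

/-! ## §2. Free stretches: constant velocity, linear path length -/

section FreeStretch

/-- On a free stretch the velocities are constant: if `(x, u)` is collision-free for a hard-sphere
trajectory `γ` (any geometry), then `v_i(τ) = v_i(x)` for `τ ∈ [x, u)` (the trajectory is the
free flight issued from time `x` there, `eq_freeFlight_of_Ioo_free`). [cite: GST2013, §4.1] -/
theorem _root_.Literature.Analysis.FluidPDE.IsHardSphereTrajectory.vel_eq_of_Ioo_free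
    {X : Type*} [TopologicalSpace X] {G : Geometry d X} {γ : ℝ → Config N d X}
    (h : IsHardSphereTrajectory G ε N γ) {x u τ : ℝ}
    (hfree : ∀ σ ∈ Ioo x u, σ ∉ collisionTimes G ε γ) (hτ : τ ∈ Ico x u) (i : Fin N) :
    (γ τ i).2 = (γ x i).2 := by
  rw [h.eq_freeFlight_of_Ioo_free hfree hτ, freeFlight_apply]

/-- On a free stretch the position of a particle on the torus is the translate
`x_i(τ) = x_i(x) + proj ((τ - x) • v_i(x))`. [cite: GST2013, §4.1] -/
theorem _root_.Literature.Analysis.FluidPDE.HardSphereFlow.pos_flow_eq_of_Ioo_free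
    (Φ : HardSphereFlow (Torus.geometry d) ε N) {z : Config N d (UnitAddTorus d)} (hz : z ∈ Φ.good)
    (i : Fin N) {x u τ : ℝ}
    (hfree : ∀ σ ∈ Ioo x u, σ ∉ collisionTimes (Torus.geometry d) ε fun s => Φ.flow s z)
    (hτ : τ ∈ Ico x u) :
    (Φ.flow τ z i).1 = (Φ.flow x z i).1 +
      Literature.Analysis.FunctionSpaces.Torus.proj ((τ - x) • (Φ.flow x z i).2) := by
  rw [(Φ.isTrajectory z hz).eq_freeFlight_of_Ioo_free hfree hτ, freeFlight_apply,
    Torus.geometry_translate]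

/-- **Displacement on a free stretch**: if `(x, u)` is collision-free then for `τ ∈ [x, u)` the
particle `i` is within `(τ - x) ‖v_i(x)‖` of its position at time `x`. [folklore] -/
theorem _root_.Literature.Analysis.FluidPDE.HardSphereFlow.euclidDist_flow_le_of_Ioo_free
    (Φ : HardSphereFlow (Torus.geometry d) ε N) {z : Config N d (UnitAddTorus d)} (hz : z ∈ Φ.good)
    (i : Fin N) {x u τ : ℝ}
    (hfree : ∀ σ ∈ Ioo x u, σ ∉ collisionTimes (Torus.geometry d) ε fun s => Φ.flow s z)
    (hτ : τ ∈ Ico x u) :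
    Torus.euclidDist (Φ.flow τ z i).1 (Φ.flow x z i).1 ≤ (τ - x) * ‖(Φ.flow x z i).2‖ := by
  rw [Φ.pos_flow_eq_of_Ioo_free hz i hfree hτ]
  refine (euclidDist_add_proj_self_le _ _).trans (le_of_eq ?_)
  rw [norm_smul, Real.norm_of_nonneg (sub_nonneg.2 hτ.1)]

/-- **Path length on a free stretch**: if `(x, u)` is collision-free then for `τ ∈ [x, u)` the
speed is constant on `[x, τ]`, so `∫_x^τ ‖v_i‖ = (τ - x) ‖v_i(x)‖`. [folklore] -/
theorem _root_.Literature.Analysis.FluidPDE.HardSphereFlow.integral_norm_vel_flow_eq_of_Ioo_free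
    (Φ : HardSphereFlow (Torus.geometry d) ε N) {z : Config N d (UnitAddTorus d)} (hz : z ∈ Φ.good)
    (i : Fin N) {x u τ : ℝ}
    (hfree : ∀ σ ∈ Ioo x u, σ ∉ collisionTimes (Torus.geometry d) ε fun s => Φ.flow s z)
    (hτ : τ ∈ Ico x u) :
    ∫ s in x..τ, ‖(Φ.flow s z i).2‖ = (τ - x) * ‖(Φ.flow x z i).2‖ := by
  have hcongr : EqOn (fun s => ‖(Φ.flow s z i).2‖) (fun _ => ‖(Φ.flow x z i).2‖) (uIcc x τ) := by
    intro s hs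
    rw [uIcc_of_le hτ.1] at hs
    show ‖(Φ.flow s z i).2‖ = ‖(Φ.flow x z i).2‖
    rw [(Φ.isTrajectory z hz).vel_eq_of_Ioo_free hfree ⟨hs.1, hs.2.trans_lt hτ.2⟩ i]
  rw [intervalIntegral.integral_congr hcongr, intervalIntegral.integral_const, smul_eq_mul]

end FreeStretch

/-! ## §3. The path-length bound -/

section PathLength

-- adapted from Summits/AtomisticToContinuum/HydrodynamicLimit/Theorems/
--   AntiMazurCoboundariesShearStressHalfDrudeDisplacement.lean (the case `t₁ = 0`)
/-- **Single-particle displacement is bounded by the path length** (torus, good orbit): for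
`t₁ ≤ t₂`, the minimal-image distance between the positions of particle `i` at times `t₂` and `t₁`
is at most `∫_{t₁}^{t₂} ‖v_i(u)‖ du`. Free flight moves `x_i` by `(t - x) v_i(x)` on every
collision-free stretch `[x, t]`, on which the speed is constant; positions are continuous across
the locally finitely many collisions; continuous induction on `[t₁, t₂]` (GST 2013 §4.1:
hard-sphere trajectories are piecewise free flight). [cite: GST2013, §4.1] -/
theorem _root_.Literature.Analysis.FluidPDE.HardSphereFlow.euclidDist_flow_le_integral_norm_vel
    (Φ : HardSphereFlow (Torus.geometry d) ε N) {z : Config N d (UnitAddTorus d)} (hz : z ∈ Φ.good)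
    (i : Fin N) {t₁ t₂ : ℝ} (h12 : t₁ ≤ t₂) :
    Torus.euclidDist (Φ.flow t₂ z i).1 (Φ.flow t₁ z i).1 ≤ ∫ u in t₁..t₂, ‖(Φ.flow u z i).2‖ := by
  have hγ := Φ.isTrajectory z hz
  have hwi := Φ.intervalIntegrable_norm_vel_flow hz i
  set P : ℝ → UnitAddTorus d := fun t => (Φ.flow t z i).1 with hP
  have hPc : Continuous P := hγ.pos_continuous i
  set S : Set ℝ := {t | Torus.euclidDist (P t) (P t₁) ≤ ∫ u in t₁..t, ‖(Φ.flow u z i).2‖} with hS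
  have hSc : IsClosed S := by
    have h1 : Continuous fun t => Torus.euclidDist (P t) (P t₁) := by
      simpa only [Function.comp_def] using
        Torus.continuous_euclidDist.comp (hPc.prodMk continuous_const)
    exact isClosed_le h1 (Φ.continuous_integral_norm_vel_flow hz i t₁)
  have hmem : t₁ ∈ S := by
    show Torus.euclidDist (P t₁) (P t₁) ≤ ∫ u in t₁..t₁, ‖(Φ.flow u z i).2‖
    rw [Torus.euclidDist_self, intervalIntegral.integral_same]
  have key : Icc t₁ t₂ ⊆ S := by
    refine (hSc.inter isClosed_Icc).Icc_subset_of_forall_mem_nhdsWithin hmem ?_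
    rintro x ⟨hxS, -⟩
    obtain ⟨u, hxu, hfree⟩ := hγ.exists_Ioo_right_free x
    refine mem_of_superset (Ioo_mem_nhdsGT hxu) fun t ht => ?_
    -- displacement and path length on the free stretch `[x, t]`
    have hstep : Torus.euclidDist (P t) (P x) ≤ (t - x) * ‖(Φ.flow x z i).2‖ :=
      Φ.euclidDist_flow_le_of_Ioo_free hz i hfree ⟨ht.1.le, ht.2⟩
    have hint : ∫ s in x..t, ‖(Φ.flow s z i).2‖ = (t - x) * ‖(Φ.flow x z i).2‖ :=
      Φ.integral_norm_vel_flow_eq_of_Ioo_free hz i hfree ⟨ht.1.le, ht.2⟩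
    show Torus.euclidDist (P t) (P t₁) ≤ ∫ u in t₁..t, ‖(Φ.flow u z i).2‖
    have hxS' : Torus.euclidDist (P x) (P t₁) ≤ ∫ u in t₁..x, ‖(Φ.flow u z i).2‖ := hxS
    rw [← intervalIntegral.integral_add_adjacent_intervals (hwi t₁ x) (hwi x t), hint]
    calc Torus.euclidDist (P t) (P t₁) ≤ Torus.euclidDist (P t) (P x) + Torus.euclidDist (P x) (P t₁) :=
          torus_euclidDist_triangle _ _ _
      _ ≤ (t - x) * ‖(Φ.flow x z i).2‖ + ∫ u in t₁..x, ‖(Φ.flow u z i).2‖ := add_le_add hstep hxS'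
      _ = (∫ u in t₁..x, ‖(Φ.flow u z i).2‖) + (t - x) * ‖(Φ.flow x z i).2‖ := add_comm _ _
  exact key ⟨h12, le_rfl⟩

/-- The path-length bound with the two positions in the other order:
`dist(x_i(t₁), x_i(t₂)) ≤ ∫_{t₁}^{t₂} ‖v_i‖` for `t₁ ≤ t₂`. [folklore] -/
theorem _root_.Literature.Analysis.FluidPDE.HardSphereFlow.euclidDist_flow_le_integral_norm_vel_comm
    (Φ : HardSphereFlow (Torus.geometry d) ε N) {z : Config N d (UnitAddTorus d)} (hz : z ∈ Φ.good)
    (i : Fin N) {t₁ t₂ : ℝ} (h12 : t₁ ≤ t₂) :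
    Torus.euclidDist (Φ.flow t₁ z i).1 (Φ.flow t₂ z i).1 ≤ ∫ u in t₁..t₂, ‖(Φ.flow u z i).2‖ := by
  rw [Torus.euclidDist_comm]
  exact Φ.euclidDist_flow_le_integral_norm_vel hz i h12

/-- The path-length bound with the two times free: `dist(x_i(t), x_i(t'))` is at most the
integral of the speed over the unordered interval `Ι t t'` between them. [folklore] -/
theorem _root_.Literature.Analysis.FluidPDE.HardSphereFlow.euclidDist_flow_le_setIntegral_norm_vel_uIoc
    (Φ : HardSphereFlow (Torus.geometry d) ε N) {z : Config N d (UnitAddTorus d)} (hz : z ∈ Φ.good)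
    (i : Fin N) (t t' : ℝ) :
    Torus.euclidDist (Φ.flow t z i).1 (Φ.flow t' z i).1 ≤ ∫ u in Ι t t', ‖(Φ.flow u z i).2‖ := by
  rcases le_total t' t with h | h
  · rw [uIoc_comm, uIoc_of_le h, ← intervalIntegral.integral_of_le h]
    exact Φ.euclidDist_flow_le_integral_norm_vel hz i h
  · rw [uIoc_of_le h, ← intervalIntegral.integral_of_le h]
    exact Φ.euclidDist_flow_le_integral_norm_vel_comm hz i h

/-- The path-length bound with the two times free, absolute-value form:
`dist(x_i(t), x_i(t')) ≤ |∫_{t'}^{t} ‖v_i‖|`. [folklore] -/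
theorem _root_.Literature.Analysis.FluidPDE.HardSphereFlow.euclidDist_flow_le_abs_integral_norm_vel
    (Φ : HardSphereFlow (Torus.geometry d) ε N) {z : Config N d (UnitAddTorus d)} (hz : z ∈ Φ.good)
    (i : Fin N) (t t' : ℝ) :
    Torus.euclidDist (Φ.flow t z i).1 (Φ.flow t' z i).1 ≤ |∫ u in t'..t, ‖(Φ.flow u z i).2‖| := by
  rcases le_total t' t with h | h
  · exact (Φ.euclidDist_flow_le_integral_norm_vel hz i h).trans (le_abs_self _)
  · rw [intervalIntegral.integral_symm, abs_neg]
    exact (Φ.euclidDist_flow_le_integral_norm_vel_comm hz i h).trans (le_abs_self _)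

/-- **Window form**: inside a time window `[a, b]`, the displacement of particle `i` from its
position at the start of the window is at most the path length over the whole window,
`dist(x_i(s), x_i(a)) ≤ ∫_a^b ‖v_i‖` for `s ∈ [a, b]`. [folklore] -/
theorem _root_.Literature.Analysis.FluidPDE.HardSphereFlow.euclidDist_flow_le_integral_norm_vel_of_mem_Icc
    (Φ : HardSphereFlow (Torus.geometry d) ε N) {z : Config N d (UnitAddTorus d)} (hz : z ∈ Φ.good)
    (i : Fin N) {a b s : ℝ} (hs : s ∈ Icc a b) :
    Torus.euclidDist (Φ.flow s z i).1 (Φ.flow a z i).1 ≤ ∫ u in a..b, ‖(Φ.flow u z i).2‖ :=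
  (Φ.euclidDist_flow_le_integral_norm_vel hz i hs.1).trans
    (Φ.integral_norm_vel_flow_mono hz i le_rfl hs.1 hs.2)

/-- Window form, from the end of the window: `dist(x_i(b), x_i(s)) ≤ ∫_a^b ‖v_i‖` for
`s ∈ [a, b]`. [folklore] -/
theorem _root_.Literature.Analysis.FluidPDE.HardSphereFlow.euclidDist_flow_le_integral_norm_vel_of_mem_Icc'
    (Φ : HardSphereFlow (Torus.geometry d) ε N) {z : Config N d (UnitAddTorus d)} (hz : z ∈ Φ.good)
    (i : Fin N) {a b s : ℝ} (hs : s ∈ Icc a b) :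
    Torus.euclidDist (Φ.flow b z i).1 (Φ.flow s z i).1 ≤ ∫ u in a..b, ‖(Φ.flow u z i).2‖ :=
  (Φ.euclidDist_flow_le_integral_norm_vel hz i hs.2).trans
    (Φ.integral_norm_vel_flow_mono hz i hs.1 hs.2 le_rfl)

/-- Window form, two times in the window: `dist(x_i(s), x_i(s')) ≤ ∫_a^b ‖v_i‖` for
`s, s' ∈ [a, b]`. [folklore] -/
theorem _root_.Literature.Analysis.FluidPDE.HardSphereFlow.euclidDist_flow_le_integral_norm_vel_of_mem_Icc₂
    (Φ : HardSphereFlow (Torus.geometry d) ε N) {z : Config N d (UnitAddTorus d)} (hz : z ∈ Φ.good)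
    (i : Fin N) {a b s s' : ℝ} (hs : s ∈ Icc a b) (hs' : s' ∈ Icc a b) :
    Torus.euclidDist (Φ.flow s z i).1 (Φ.flow s' z i).1 ≤ ∫ u in a..b, ‖(Φ.flow u z i).2‖ := by
  rcases le_total s' s with h | h
  · exact (Φ.euclidDist_flow_le_integral_norm_vel hz i h).trans
      (Φ.integral_norm_vel_flow_mono hz i hs'.1 h hs.2)
  · exact (Φ.euclidDist_flow_le_integral_norm_vel_comm hz i h).trans
      (Φ.integral_norm_vel_flow_mono hz i hs.1 h hs'.2)

/-- Set-integral form over `Ioc t₁ t₂` (the interval integral unfolded,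
`intervalIntegral.integral_of_le`). [folklore] -/
theorem _root_.Literature.Analysis.FluidPDE.HardSphereFlow.euclidDist_flow_le_setIntegral_norm_vel_Ioc
    (Φ : HardSphereFlow (Torus.geometry d) ε N) {z : Config N d (UnitAddTorus d)} (hz : z ∈ Φ.good)
    (i : Fin N) {t₁ t₂ : ℝ} (h12 : t₁ ≤ t₂) :
    Torus.euclidDist (Φ.flow t₂ z i).1 (Φ.flow t₁ z i).1 ≤ ∫ u in Ioc t₁ t₂, ‖(Φ.flow u z i).2‖ := by
  rw [← intervalIntegral.integral_of_le h12]
  exact Φ.euclidDist_flow_le_integral_norm_vel hz i h12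

/-- Set-integral form over `Icc t₁ t₂` (endpoints are Lebesgue-null). [folklore] -/
theorem _root_.Literature.Analysis.FluidPDE.HardSphereFlow.euclidDist_flow_le_setIntegral_norm_vel_Icc
    (Φ : HardSphereFlow (Torus.geometry d) ε N) {z : Config N d (UnitAddTorus d)} (hz : z ∈ Φ.good)
    (i : Fin N) {t₁ t₂ : ℝ} (h12 : t₁ ≤ t₂) :
    Torus.euclidDist (Φ.flow t₂ z i).1 (Φ.flow t₁ z i).1 ≤ ∫ u in Icc t₁ t₂, ‖(Φ.flow u z i).2‖ := by
  rw [integral_Icc_eq_integral_Ioc]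
  exact Φ.euclidDist_flow_le_setIntegral_norm_vel_Ioc hz i h12

/-- Set-integral form over `Ioo t₁ t₂` (endpoints are Lebesgue-null). [folklore] -/
theorem _root_.Literature.Analysis.FluidPDE.HardSphereFlow.euclidDist_flow_le_setIntegral_norm_vel_Ioo
    (Φ : HardSphereFlow (Torus.geometry d) ε N) {z : Config N d (UnitAddTorus d)} (hz : z ∈ Φ.good)
    (i : Fin N) {t₁ t₂ : ℝ} (h12 : t₁ ≤ t₂) :
    Torus.euclidDist (Φ.flow t₂ z i).1 (Φ.flow t₁ z i).1 ≤ ∫ u in Ioo t₁ t₂, ‖(Φ.flow u z i).2‖ := by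
  rw [← integral_Ioc_eq_integral_Ioo]
  exact Φ.euclidDist_flow_le_setIntegral_norm_vel_Ioc hz i h12

/-- Set-integral form over `Ico t₁ t₂` (endpoints are Lebesgue-null; the natural form for
half-open time windows `[kw, (k+1)w)`). [folklore] -/
theorem _root_.Literature.Analysis.FluidPDE.HardSphereFlow.euclidDist_flow_le_setIntegral_norm_vel_Ico
    (Φ : HardSphereFlow (Torus.geometry d) ε N) {z : Config N d (UnitAddTorus d)} (hz : z ∈ Φ.good)
    (i : Fin N) {t₁ t₂ : ℝ} (h12 : t₁ ≤ t₂) :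
    Torus.euclidDist (Φ.flow t₂ z i).1 (Φ.flow t₁ z i).1 ≤ ∫ u in Ico t₁ t₂, ‖(Φ.flow u z i).2‖ := by
  rw [integral_Ico_eq_integral_Ioo]
  exact Φ.euclidDist_flow_le_setIntegral_norm_vel_Ioo hz i h12

/-- The path-length bound implies the speed bound of `HardSphereFlow.euclidDist_flow_self_le`:
`dist(x_i(t₂), x_i(t₁)) ≤ ∫_{t₁}^{t₂} ‖v_i‖ ≤ √(2E(z)) (t₂ - t₁)` (consistency check; the two
proofs are independent). [folklore] -/
theorem _root_.Literature.Analysis.FluidPDE.HardSphereFlow.euclidDist_flow_le_integral_norm_vel_trans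
    (Φ : HardSphereFlow (Torus.geometry d) ε N) {z : Config N d (UnitAddTorus d)} (hz : z ∈ Φ.good)
    (i : Fin N) {t₁ t₂ : ℝ} (h12 : t₁ ≤ t₂) :
    Torus.euclidDist (Φ.flow t₂ z i).1 (Φ.flow t₁ z i).1 ≤ ∫ u in t₁..t₂, ‖(Φ.flow u z i).2‖ ∧
      ∫ u in t₁..t₂, ‖(Φ.flow u z i).2‖ ≤ Real.sqrt (2 * configEnergy z) * (t₂ - t₁) :=
  ⟨Φ.euclidDist_flow_le_integral_norm_vel hz i h12, Φ.integral_norm_vel_flow_le hz i h12⟩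

end PathLength

end

end Literature.MathematicalPhysics.KineticTheory
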